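import Summits.HodgeConjecture.HodgeConjecture.Theorems.MarkmanPartnerTransportPicardThreeK3SquaresQuotientDescent
import Summits.HodgeConjecture.HodgeConjecture.Theorems.MarkmanPartnerTransportPicardThreeK3SquaresSectorIff
import Summits.HodgeConjecture.HodgeConjecture.Theorems.MarkmanPartnerTransportPicardThreeK3SquaresSqrtSixCycle

/-!
# Route MarkmanPartnerTransport · crux `PicardThreeK3Squares` (stmt-HodgeConjecture-19652) —
# HC⁴ for K3 squares descends along an algebraic similitude datum (HC form of `…QuotientDescent`)

`…QuotientDescent` transports Varesco's cycle-induced-sector clause from `Z` to `X` along a datum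
`(Z, γ)` for `X` (an algebraic class on `X ⊗ Z` acting as a rational, type-preserving similitude of
`T(Z)` onto `T(X)`, e.g. Varesco's symplectic-quotient data). With Varesco's equivalence HC⁴(S ⊗ S) ⟺
clause (`SectorIff.cycleInducedSector_of_hodgeConjectureFor_square`,
`CycleInducedSector.hodgeConjectureFor_square_of_cycleInducedSector`) this is:

* `hodgeConjectureFor_square_of_datum` — **HC⁴(Z ⊗ Z) ⟹ HC⁴(X ⊗ X); no named fact.** With the named
  facts `Varesco2023_quotientSimilitude_two/three_of_transcendental_embedding`: HC for the square of the
  Nikulin (resp. order-`3`) quotient partner of a projective K3 surface `X` with `ρ(X) ≥ 11` (resp. `≥ 15`)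
  implies HC for `X ⊗ X` (`hodgeConjectureFor_square_of_quotientPartner_two/three`).

No definition, no sorry. Prover seat hodge-nonav-19652-p1 (gen 5), `--supports stmt-HodgeConjecture-19652`.

References: M. Varesco, Math. Z. 305 (2023) §2 (p. 8), Prop. 2.5, Prop. 2.11; W. Fulton, *Intersection
theory*, §16.1 Prop. 16.1.1.
-/

set_option linter.dupNamespace false

noncomputable section

namespace Summit.HodgeConjecture.HodgeConjecture.Theorems.MarkmanPartnerTransport.QuotientSimilitude

open scoped Manifold
open Module CategoryTheory MonoidalCategory CartesianMonoidalCategory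
open Literature.AlgebraicGeometry Literature.AlgebraicGeometry.Motives Literature.AlgebraicGeometry.HodgeTheory
open Literature.AlgebraicGeometry.Surfaces
open Literature.AlgebraicTopology.SingularHomology
open Summit.HodgeConjecture.HodgeConjecture.Theorems
open Summit.HodgeConjecture.HodgeConjecture.Theorems.NikulinTwinTransport
open Summit.HodgeConjecture.HodgeConjecture.Theorems.MarkmanPartnerTransport

variable {S Z : SchemeOver ℂ}

/-- `MarkedK3[S, η, p, x]`: VERBATIM the `let MarkedK3 := …` binder of the route declaration
`PicardThreeK3Squares`. Local notation only. -/
local notation3 (prettyPrint := false) "MarkedK3[" S ", " η ", " p ", " x "]" =>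
  (p ≠ 0 ∧ (IsIntegralClass p ∧
    (∀ q : complexBetti S (2 * 2), IsIntegralClass q → ∃ n : ℤ, q = n • p) ∧
    (∀ c : complexBetti S (2 * 1), IsIntegralClass c ↔ ∃ v : K3Index → ℤ, η c = fun i => (v i : ℂ)) ∧
    (∀ a b : complexBetti S (2 * 1),
      cupProduct (rfl : 2 * 1 + 2 * 1 = 2 * 2) a b = k3Form (η a) (η b) • p) ∧
    IsOfHodgeType 2 S (2 * 1) 2 0 (LinearEquiv.symm η x) ∧
    (∀ τ : complexBetti S (2 * 1), IsOfHodgeType 2 S (2 * 1) 2 0 τ →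
      ∃ t : ℂ, τ = t • LinearEquiv.symm η x)) ∧
    (k3Form x x = 0 ∧ 0 < (k3Form (star x) x).re ∧
      ∃ u : K3Index → ℤ, k3Form (fun i => (u i : ℂ)) x = 0 ∧ 0 < ∑ i, ∑ j, u i * k3Gram i j * u j))

/-- `Corr[μ, X, Y, hX, hY ; γ, y] = fst_* (snd^* y ∪ γ)` (`hX hY : IsSmoothProjective 2 _`). Local notation only. -/
local notation3 (prettyPrint := false) "Corr[" μ ", " X ", " Y ", " hX ", " hY " ; " γ ", " y "]" =>
  complexGysin μ (IsSmoothProjective.tensor_holds hX hY) hX (SemiCartesianMonoidalCategory.fst X Y)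
    (rfl : 2 * 1 + 2 * 2 + 2 * 2 = 2 * 1 + 2 * (2 + 2))
    (cupProduct (rfl : 2 * 1 + 2 * 2 = 2 * 1 + 2 * 2)
      (complexBetti.map (SemiCartesianMonoidalCategory.snd X Y) (2 * 1) y) γ)

/-- `Transp[X, Y ; γ] = swap^* γ`. Local notation only. -/
local notation3 (prettyPrint := false) "Transp[" X ", " Y " ; " γ "]" =>
  complexBetti.map (CartesianMonoidalCategory.lift (SemiCartesianMonoidalCategory.snd Y X)
    (SemiCartesianMonoidalCategory.fst Y X)) (2 * 2) γ

/-- `Datum[X, Z, hX, hZ, η, ηZ ; γ, m]`: `γ` is an algebraic class on `X ⊗ Z` whose action `[γ]_*` is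
rational, Hodge-type preserving, maps `T(Z)` onto `T(X)` and scales the forms there by `m` in the
markings. Local notation only. -/
local notation3 (prettyPrint := false) "Datum[" X ", " Z ", " hX ", " hZ ", " η ", " ηZ " ; " γ ", " m "]" =>
  (γ ∈ algebraicClasses (X ⊗ Z) 2 ∧
    (∀ y, IsRationalClass y → IsRationalClass (Corr[complexOrientationFamily, X, Z, hX, hZ ; γ, y])) ∧
    (∀ (i j : ℕ) y, IsOfHodgeType 2 Z (2 * 1) i j y →
      IsOfHodgeType 2 X (2 * 1) i j (Corr[complexOrientationFamily, X, Z, hX, hZ ; γ, y])) ∧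
    (∀ y ∈ transcendentalSubspace Z,
      Corr[complexOrientationFamily, X, Z, hX, hZ ; γ, y] ∈ transcendentalSubspace X) ∧
    (∀ z ∈ transcendentalSubspace X, ∃ y ∈ transcendentalSubspace Z,
      Corr[complexOrientationFamily, X, Z, hX, hZ ; γ, y] = z) ∧
    (∀ a ∈ transcendentalSubspace Z, ∀ b ∈ transcendentalSubspace Z,
      k3Form (η (Corr[complexOrientationFamily, X, Z, hX, hZ ; γ, a]))
        (η (Corr[complexOrientationFamily, X, Z, hX, hZ ; γ, b])) = m * k3Form (ηZ a) (ηZ b)))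

/-! ### HC⁴ descends along a datum -/

/-- **HC⁴(Z ⊗ Z) ⟹ HC⁴(X ⊗ X) along an algebraic similitude datum `(Z, γ)` for `X`** — no named
fact: Varesco's equivalence HC⁴ ⟺ sector clause (`…SectorIff`, `…CycleInducedSector`) on both sides of
`cycleInducedSector_of_datum`. E.g. HC for the square of the Nikulin-quotient partner of a projective K3
surface `X` with `ρ(X) ≥ 11` implies HC for `X ⊗ X`. [cite: Varesco2023, §2 (p. 8)] [cite: Fulton1998, §16.1 Prop. 16.1.1] -/
theorem hodgeConjectureFor_square_of_datum (hS : IsK3Surface S)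
    (η : complexBetti S (2 * 1) ≃ₗ[ℂ] (K3Index → ℂ)) (p : complexBetti S (2 * 2)) (x : K3Index → ℂ)
    (hM : MarkedK3[S, η, p, x]) (hZ : IsK3Surface Z)
    (ηZ : complexBetti Z (2 * 1) ≃ₗ[ℂ] (K3Index → ℂ)) (pZ : complexBetti Z (2 * 2)) (xZ : K3Index → ℂ)
    (hMZ : MarkedK3[Z, ηZ, pZ, xZ]) {m : ℂ} (hm : m ≠ 0) (hmrat : ∃ q : ℚ, (q : ℂ) = m)
    (γ : complexBetti (S ⊗ Z) (2 * 2)) (hD : Datum[S, Z, hS.1, hZ.1, η, ηZ ; γ, m])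
    (hHC : HodgeConjectureFor 4 (Z ⊗ Z)) : HodgeConjectureFor 4 (S ⊗ S) :=
  CycleInducedSector.hodgeConjectureFor_square_of_cycleInducedSector complexOrientationFamily hS.1
    (cycleInducedSector_of_datum hS η p x hM hZ ηZ pZ xZ hMZ hm hmrat γ hD
      (SectorIff.cycleInducedSector_of_hodgeConjectureFor_square complexOrientationFamily hZ.1 hHC))


/-- **HC⁴ for `X ⊗ X` from HC⁴ for the square of a Nikulin-quotient partner, `ρ(X) ≥ 11`.** For a marked
projective K3 surface `(X, η, p, x)` with `ρ(X) ≥ 11`, the lattice criterion `T(X)_ℚ ↪ (U³ ⊕ E₈(−2)) ⊗ ℚ`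
is automatic (Kitaoka); if HC⁴ holds for the square of EVERY marked partner `Z` supplied by
`Varesco2023_quotientSimilitude_two_of_transcendental_embedding` (an algebraic `2`-similitude
`T(Z) ↠ T(X)`), then HC⁴(X ⊗ X). [cite: Varesco2023, §2 (starting observation) and Prop. 2.5]
[cite: Kitaoka1993, Ch. 4 Cor. 4.1.4] -/
theorem hodgeConjectureFor_square_of_quotientPartner_two
    (hQ2 : Varesco2023_quotientSimilitude_two_of_transcendental_embedding) (hS : IsK3Surface S)
    (η : complexBetti S (2 * 1) ≃ₗ[ℂ] (K3Index → ℂ)) (p : complexBetti S (2 * 2)) (x : K3Index → ℂ)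
    (hM : MarkedK3[S, η, p, x]) (hρ : 11 ≤ Module.finrank ℂ ↥(algebraicClasses S 1))
    (hZ : ∀ (Z : SchemeOver ℂ) (hZ : IsK3Surface Z) (ηZ : complexBetti Z (2 * 1) ≃ₗ[ℂ] (K3Index → ℂ))
      (pZ : complexBetti Z (2 * 2)) (xZ : K3Index → ℂ), MarkedK3[Z, ηZ, pZ, xZ] →
      ∀ γ : complexBetti (S ⊗ Z) (2 * 2), Datum[S, Z, hS.1, hZ.1, η, ηZ ; γ, (2 : ℂ)] →
      HodgeConjectureFor 4 (Z ⊗ Z)) :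
    HodgeConjectureFor 4 (S ⊗ S) := by
  obtain ⟨hp₀, ⟨hpint, hpgen, hηint, hηcup, -, -⟩, -⟩ := id hM
  obtain ⟨ι, hiso, hinj⟩ := NikulinIsogeny.exists_transcendentalEmbedding_weightedSumSquares hS η p x hM
    (![1, 1, 1, -1, -1, -1, -1, -1, -1, -1, -1, -1, -1, -1] : Fin 14 → ℚ) SqrtSix.u3e8Weights_ne_zero
    (by rw [SqrtSix.ncard_u3e8Weights_pos]) (by rw [SqrtSix.ncard_u3e8Weights_neg]; omega) (by omega)
  obtain ⟨Z, hZ', ηZ, pZ, xZ, hMZ, φ, γ, hγalg, hφ, hφrat, hφtyp, hφT, hφonto, hφmul⟩ :=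
    hQ2 hS η p hp₀ hpint hpgen hηint hηcup ι hiso hinj
  have hD : Datum[S, Z, hS.1, hZ'.1, η, ηZ ; γ, (2 : ℂ)] :=
    ⟨hγalg, fun y hy ↦ by rw [← hφ]; exact hφrat y hy, fun i j y hy ↦ by rw [← hφ]; exact hφtyp i j y hy,
      fun y hy ↦ by rw [← hφ]; exact hφT y hy,
      fun z hz ↦ by
        obtain ⟨y, hy, hyz⟩ := hφonto z hz
        exact ⟨y, hy, by rw [← hφ]; exact hyz⟩,
      fun a ha b hb ↦ by rw [← hφ, ← hφ]; exact hφmul a ha b hb⟩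
  exact hodgeConjectureFor_square_of_datum hS η p x hM hZ' ηZ pZ xZ hMZ two_ne_zero ⟨2, by norm_num⟩ γ hD
    (hZ Z hZ' ηZ pZ xZ hMZ γ hD)

end Summit.HodgeConjecture.HodgeConjecture.Theorems.MarkmanPartnerTransport.QuotientSimilitude

end
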